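import Literature.Combinatorics.Extremal.RuledSurfaceCrossingPoints
import Literature.Combinatorics.Extremal.RuledSurfaceSpecialLines
import Mathlib.Algebra.Module.LinearMap.Polynomial
import Mathlib.LinearAlgebra.Matrix.ToLinearEquiv
import HarnessLib

/-!
# Crossing points on non-special lines of a ruled surface (Kollár's Proposition 55, affine)

Topic `Literature/Combinatorics/Extremal`. Everything in this file is PROVED.

We transport the key lemma `card_crossing_le_of_axis` (at most `d - 1` crossing points on the
axis `{x₀ = x₁ = 0}`) to an arbitrary line by an affine change of coordinates, and combine it
with `exists_finset_special` (at most two special lines) into the structural statement about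
ruled surfaces used by the Guth–Katz / Kollár incidence bounds:

* `card_crossing_le` — on an irreducible surface `S` of degree `d ≥ 2` (algebraically closed
  field, not a cylinder, every point on a line of `S`), a line `ℓ ⊆ S` coplanar with only
  finitely many lines of `S` carries at most `d - 1` points lying on another such line.
  [cite: GuthKatz2015, Lemma 3.4] [cite: Kollar2015, Proposition 55 (5)]
* `crossing_bound_of_generically_ruled` — **Kollár's Proposition 55 (4)+(5), affine form with
  `d - 1`**: for `f` irreducible of degree `d ≥ 3` over an algebraically closed field,
  generically ruled, `{f = 0}` neither a cone nor a cylinder, there is a set `E` of at most two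
  lines such that every line `ℓ ∉ E` of the surface carries at most `d - 1` points lying on
  other lines `∉ E` of the surface. [cite: Kollar2015, Proposition 55 (4), (5)]
  [cite: GuthKatz2015, Corollary 3.6, Lemma 3.4]

The change of coordinates `x ↦ M x + a` acts on polynomials through `linSubst M ∘ translate a`
(`Matrix.toMvPolynomial`, an algebra automorphism for `det M ≠ 0`: `linSubstEquiv`) and on
lines through `AffineSubspace.map` of the affine equivalence `affEquiv a M`; the dictionary
(`eval_affSubst`, `mem_linesOn_map_iff`, `copl_map_iff`, `map_lineOf`) is routine.

## References
* [Kollar2015] J. Kollár, *Szemerédi–Trotter-type theorems in dimension 3*, Adv. Math. 271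
  (2015) 30–61, §7, Proposition 55.
* [GuthKatz2015] L. Guth, N. H. Katz, *On the Erdős distinct distances problem in the plane*,
  Ann. of Math. 181 (2015) 155–190, §3, Lemma 3.4, Corollary 3.6.
-/

namespace Literature.Combinatorics.Extremal

open MvPolynomial Finset
open scoped Matrix

variable {K : Type*} [Field K]

/-! ### Linear and affine substitutions in three variables -/

section Subst

/-- The linear substitution `f ↦ f(M x)`. [folklore] -/
noncomputable def linSubst (M : Matrix (Fin 3) (Fin 3) K) :
    MvPolynomial (Fin 3) K →ₐ[K] MvPolynomial (Fin 3) K :=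
  bind₁ M.toMvPolynomial

/-- `linSubst M f` evaluates at `x` to `f(M x)`. [folklore] -/
theorem eval_linSubst (M : Matrix (Fin 3) (Fin 3) K) (f : MvPolynomial (Fin 3) K)
    (x : Fin 3 → K) : eval x (linSubst M f) = eval (M *ᵥ x) f := by
  have h : (fun i => eval x (M.toMvPolynomial i)) = M *ᵥ x :=
    funext fun i => Matrix.toMvPolynomial_eval_eq_apply M i x
  rw [← h]
  exact eval₂Hom_bind₁ _ _ _ _

/-- Linear substitutions compose (contravariantly). [folklore] -/
theorem linSubst_linSubst (M N : Matrix (Fin 3) (Fin 3) K) (f : MvPolynomial (Fin 3) K) :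
    linSubst M (linSubst N f) = linSubst (N * M) f := by
  have h : ∀ i, bind₁ M.toMvPolynomial (N.toMvPolynomial i) = (N * M).toMvPolynomial i :=
    fun i => (Matrix.toMvPolynomial_mul N M i).symm
  unfold linSubst
  rw [bind₁_bind₁]
  simp only [h]

/-- The identity substitution. [folklore] -/
theorem linSubst_one (f : MvPolynomial (Fin 3) K) :
    linSubst (1 : Matrix (Fin 3) (Fin 3) K) f = f := by
  unfold linSubst
  rw [Matrix.toMvPolynomial_one, bind₁_X_left, AlgHom.id_apply]

/-- An invertible linear substitution is an algebra automorphism. [folklore] -/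
noncomputable def linSubstEquiv (M : Matrix (Fin 3) (Fin 3) K) (hM : IsUnit M.det) :
    MvPolynomial (Fin 3) K ≃ₐ[K] MvPolynomial (Fin 3) K :=
  AlgEquiv.ofAlgHom (linSubst M) (linSubst M⁻¹)
    (AlgHom.ext fun f => by
      rw [AlgHom.comp_apply, linSubst_linSubst, Matrix.nonsing_inv_mul M hM, linSubst_one,
        AlgHom.id_apply])
    (AlgHom.ext fun f => by
      rw [AlgHom.comp_apply, linSubst_linSubst, Matrix.mul_nonsing_inv M hM, linSubst_one,
        AlgHom.id_apply])

/-- The underlying map of `linSubstEquiv`. [folklore] -/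
@[simp] theorem linSubstEquiv_apply (M : Matrix (Fin 3) (Fin 3) K) (hM : IsUnit M.det)
    (f : MvPolynomial (Fin 3) K) : linSubstEquiv M hM f = linSubst M f := rfl

/-- A linear substitution does not raise the total degree. [folklore] -/
theorem totalDegree_linSubst_le (M : Matrix (Fin 3) (Fin 3) K) (f : MvPolynomial (Fin 3) K) :
    (linSubst M f).totalDegree ≤ f.totalDegree := by
  unfold linSubst
  rw [← aeval_eq_bind₁]
  exact totalDegree_aeval_le_of_le_one _ (fun i => Matrix.toMvPolynomial_totalDegree_le M i) f

/-- An invertible linear substitution preserves the total degree. [folklore] -/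
theorem totalDegree_linSubst (M : Matrix (Fin 3) (Fin 3) K) (hM : IsUnit M.det)
    (f : MvPolynomial (Fin 3) K) : (linSubst M f).totalDegree = f.totalDegree := by
  refine le_antisymm (totalDegree_linSubst_le M f) ?_
  have h : linSubst M⁻¹ (linSubst M f) = f := by
    rw [linSubst_linSubst, Matrix.mul_nonsing_inv M hM, linSubst_one]
  conv_lhs => rw [← h]
  exact totalDegree_linSubst_le _ _

/-- The affine substitution `f ↦ f(M x + a)` evaluates as expected. [folklore] -/
theorem eval_affSubst (a : Fin 3 → K) (M : Matrix (Fin 3) (Fin 3) K) (f : MvPolynomial (Fin 3) K)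
    (x : Fin 3 → K) : eval x (linSubst M (translate a f)) = eval (M *ᵥ x + a) f := by
  rw [eval_linSubst, eval_translate]

/-- An invertible affine substitution preserves irreducibility. [folklore] -/
theorem irreducible_affSubst_iff {a : Fin 3 → K} {M : Matrix (Fin 3) (Fin 3) K}
    (hM : IsUnit M.det) {f : MvPolynomial (Fin 3) K} :
    Irreducible (linSubst M (translate a f)) ↔ Irreducible f := by
  have h1 := MulEquiv.irreducible_iff (linSubstEquiv M hM) (x := translate a f)
  have h2 := MulEquiv.irreducible_iff (translateEquiv a) (x := f)
  rw [linSubstEquiv_apply] at h1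
  rw [translateEquiv_apply] at h2
  exact h1.trans h2

/-- An invertible affine substitution preserves the total degree. [folklore] -/
theorem totalDegree_affSubst (a : Fin 3 → K) {M : Matrix (Fin 3) (Fin 3) K} (hM : IsUnit M.det)
    (f : MvPolynomial (Fin 3) K) : (linSubst M (translate a f)).totalDegree = f.totalDegree := by
  rw [totalDegree_linSubst M hM, totalDegree_translate]

/-- A matrix with invertible determinant has trivial kernel. [folklore] -/
theorem mulVec_ne_zero {M : Matrix (Fin 3) (Fin 3) K} (hM : IsUnit M.det) {v : Fin 3 → K}
    (hv : v ≠ 0) : M *ᵥ v ≠ 0 := by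
  intro h
  apply hv
  calc v = (M⁻¹ * M) *ᵥ v := by rw [Matrix.nonsing_inv_mul M hM, Matrix.one_mulVec]
    _ = 0 := by rw [← Matrix.mulVec_mulVec, h, Matrix.mulVec_zero]

/-- An invertible matrix sending `e₂` to a given nonzero vector `u` (columns `e_j, e_k, u`).
[folklore] -/
theorem exists_matrix_mulVec_single_eq {u : Fin 3 → K} (hu : u ≠ 0) :
    ∃ M : Matrix (Fin 3) (Fin 3) K, IsUnit M.det ∧ M *ᵥ Pi.single 2 1 = u := by
  by_cases h2 : u 2 ≠ 0
  · refine ⟨!![1, 0, u 0; 0, 1, u 1; 0, 0, u 2], ?_, ?_⟩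
    · rw [isUnit_iff_ne_zero, Matrix.det_fin_three]
      simpa using h2
    · ext i
      fin_cases i <;> simp [Matrix.mulVec, dotProduct, Fin.sum_univ_three]
  by_cases h1 : u 1 ≠ 0
  · refine ⟨!![1, 0, u 0; 0, 0, u 1; 0, 1, u 2], ?_, ?_⟩
    · rw [isUnit_iff_ne_zero, Matrix.det_fin_three]
      simpa using h1
    · ext i
      fin_cases i <;> simp [Matrix.mulVec, dotProduct, Fin.sum_univ_three]
  have h0 : u 0 ≠ 0 := by
    intro h0
    push Not at h2 h1
    apply hu
    funext i
    fin_cases i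
    · exact h0
    · exact h1
    · exact h2
  refine ⟨!![0, 0, u 0; 1, 0, u 1; 0, 1, u 2], ?_, ?_⟩
  · rw [isUnit_iff_ne_zero, Matrix.det_fin_three]
    simpa using h0
  · ext i
    fin_cases i <;> simp [Matrix.mulVec, dotProduct, Fin.sum_univ_three]

end Subst

/-! ### The affine equivalence `x ↦ M x + a` and its action on lines -/

section AffEquiv

/-- The affine equivalence `x ↦ M x + a` of `K³` for `det M ≠ 0`. [folklore] -/
noncomputable def affEquiv (a : Fin 3 → K) (M : Matrix (Fin 3) (Fin 3) K) (hM : IsUnit M.det) :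
    (Fin 3 → K) ≃ᵃ[K] (Fin 3 → K) :=
  ((M.toLinearEquiv' (Matrix.invertibleOfIsUnitDet M hM)).toAffineEquiv).trans
    (AffineEquiv.constVAdd K (Fin 3 → K) a)

/-- `affEquiv a M hM x = M x + a`. [folklore] -/
@[simp] theorem affEquiv_apply (a : Fin 3 → K) (M : Matrix (Fin 3) (Fin 3) K) (hM : IsUnit M.det)
    (x : Fin 3 → K) : affEquiv a M hM x = M *ᵥ x + a := by
  simp only [affEquiv, AffineEquiv.coe_trans, Function.comp_apply, LinearEquiv.coe_toAffineEquiv,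
    AffineEquiv.constVAdd_apply, vadd_eq_add, add_comm a]
  change Matrix.toLin' M x + a = M *ᵥ x + a
  rw [Matrix.toLin'_apply]

/-- The linear part of `affEquiv a M hM` is `M`. [folklore] -/
@[simp] theorem affEquiv_linear_apply (a : Fin 3 → K) (M : Matrix (Fin 3) (Fin 3) K)
    (hM : IsUnit M.det) (w : Fin 3 → K) : (affEquiv a M hM).linear w = M *ᵥ w := by
  have h := (affEquiv a M hM : (Fin 3 → K) →ᵃ[K] (Fin 3 → K)).linearMap_vsub w 0
  rw [AffineEquiv.linear_toAffineMap] at h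
  simp only [vsub_eq_sub, sub_zero, AffineEquiv.coe_toAffineMap, LinearEquiv.coe_coe,
    affEquiv_apply, Matrix.mulVec_zero, zero_add, add_sub_cancel_right] at h
  exact h

variable (E : (Fin 3 → K) ≃ᵃ[K] (Fin 3 → K))

/-- An affine equivalence preserves the dimension of affine subspaces. [folklore] -/
theorem finrank_direction_map (m : AffineSubspace K (Fin 3 → K)) :
    Module.finrank K (m.map (E : (Fin 3 → K) →ᵃ[K] (Fin 3 → K))).direction =
      Module.finrank K m.direction := by
  rw [AffineSubspace.map_direction, AffineEquiv.linear_toAffineMap, LinearEquiv.finrank_map_eq]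

/-- Mapping affine subspaces by an affine equivalence is injective. [folklore] -/
theorem map_injective :
    Function.Injective (AffineSubspace.map (E : (Fin 3 → K) →ᵃ[K] (Fin 3 → K))) := by
  intro s t h
  have h' := congrArg (fun u : AffineSubspace K (Fin 3 → K) => (u : Set (Fin 3 → K))) h
  simp only [AffineSubspace.coe_map, AffineEquiv.coe_toAffineMap] at h'
  exact SetLike.coe_injective ((Set.image_injective.2 E.injective) h')

/-- `map E ∘ map E⁻¹ = id` on affine subspaces. [folklore] -/
theorem map_symm_map (m : AffineSubspace K (Fin 3 → K)) :
    (m.map (E.symm : (Fin 3 → K) →ᵃ[K] (Fin 3 → K))).map (E : (Fin 3 → K) →ᵃ[K] (Fin 3 → K))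
      = m := by
  rw [AffineSubspace.map_map]
  have : (E : (Fin 3 → K) →ᵃ[K] (Fin 3 → K)).comp (E.symm : (Fin 3 → K) →ᵃ[K] (Fin 3 → K)) =
      AffineMap.id K _ := by
    ext x
    simp
  rw [this, AffineSubspace.map_id]

/-- `map E⁻¹ ∘ map E = id` on affine subspaces. [folklore] -/
theorem map_map_symm (m : AffineSubspace K (Fin 3 → K)) :
    (m.map (E : (Fin 3 → K) →ᵃ[K] (Fin 3 → K))).map (E.symm : (Fin 3 → K) →ᵃ[K] (Fin 3 → K))
      = m := by
  rw [AffineSubspace.map_map]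
  have : (E.symm : (Fin 3 → K) →ᵃ[K] (Fin 3 → K)).comp (E : (Fin 3 → K) →ᵃ[K] (Fin 3 → K)) =
      AffineMap.id K _ := by
    ext x
    simp
  rw [this, AffineSubspace.map_id]

/-- Coplanarity is invariant under affine equivalences. [folklore] -/
theorem copl_map_iff (ℓ m : AffineSubspace K (Fin 3 → K)) :
    Copl (ℓ.map (E : (Fin 3 → K) →ᵃ[K] (Fin 3 → K))) (m.map (E : (Fin 3 → K) →ᵃ[K] (Fin 3 → K)))
      ↔ Copl ℓ m := by
  unfold Copl
  refine or_congr ?_ ?_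
  · constructor
    · rintro ⟨z, hzℓ, hzm⟩
      obtain ⟨y, hy, rfl⟩ := AffineSubspace.mem_map.1 hzℓ
      obtain ⟨y', hy', hyy⟩ := AffineSubspace.mem_map.1 hzm
      obtain rfl := E.injective hyy
      exact ⟨y', hy, hy'⟩
    · rintro ⟨y, hyℓ, hym⟩
      exact ⟨E y, AffineSubspace.mem_map.2 ⟨y, hyℓ, rfl⟩, AffineSubspace.mem_map.2 ⟨y, hym, rfl⟩⟩
  · rw [AffineSubspace.map_direction, AffineSubspace.map_direction, AffineEquiv.linear_toAffineMap]
    exact (Submodule.map_injective_of_injective E.linear.injective).eq_iff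

/-- Lines of `{f = 0}` correspond to lines of `{g = 0}` when `g = f ∘ E`. [folklore] -/
theorem mem_linesOn_map_iff {f g : MvPolynomial (Fin 3) K} (hfg : ∀ x, eval x g = eval (E x) f)
    (m : AffineSubspace K (Fin 3 → K)) :
    m.map (E : (Fin 3 → K) →ᵃ[K] (Fin 3 → K)) ∈ linesOn f ↔ m ∈ linesOn g := by
  rw [mem_linesOn, mem_linesOn, finrank_direction_map]
  refine and_congr Iff.rfl ⟨fun h y hy => ?_, fun h z hz => ?_⟩
  · rw [hfg]
    exact h _ (AffineSubspace.mem_map.2 ⟨y, hy, rfl⟩)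
  · obtain ⟨y, hy, rfl⟩ := AffineSubspace.mem_map.1 hz
    rw [AffineEquiv.coe_toAffineMap, ← hfg]
    exact h y hy

/-- The image of a parametrized line. [folklore] -/
theorem map_lineOf (b w : Fin 3 → K) :
    (lineOf b w).map (E : (Fin 3 → K) →ᵃ[K] (Fin 3 → K)) = lineOf (E b) (E.linear w) := by
  have key : ∀ t : K, E (b + t • w) = E b + t • E.linear w := fun t => by
    rw [add_comm b, ← vadd_eq_add, E.map_vadd, vadd_eq_add, map_smul, add_comm]
  ext z
  rw [AffineSubspace.mem_map]
  simp only [mem_lineOf, AffineEquiv.coe_toAffineMap]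
  constructor
  · rintro ⟨y, ⟨t, rfl⟩, rfl⟩
    exact ⟨t, key t⟩
  · rintro ⟨t, rfl⟩
    exact ⟨b + t • w, ⟨t, rfl⟩, key t⟩

/-- Finiteness of "lines of the surface coplanar with `ℓ`" is invariant under the
correspondence. [folklore] -/
theorem finite_copl_map_iff {f g : MvPolynomial (Fin 3) K} (hfg : ∀ x, eval x g = eval (E x) f)
    (ℓ : AffineSubspace K (Fin 3 → K)) :
    Set.Finite {m' | m' ∈ linesOn f ∧ Copl (ℓ.map (E : (Fin 3 → K) →ᵃ[K] (Fin 3 → K))) m'} ↔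
      Set.Finite {m | m ∈ linesOn g ∧ Copl ℓ m} := by
  have h1 : {m | m ∈ linesOn g ∧ Copl ℓ m} =
      AffineSubspace.map (E : (Fin 3 → K) →ᵃ[K] (Fin 3 → K)) ⁻¹'
        {m' | m' ∈ linesOn f ∧ Copl (ℓ.map (E : (Fin 3 → K) →ᵃ[K] (Fin 3 → K))) m'} := by
    ext m
    simp only [Set.mem_preimage, Set.mem_setOf_eq]
    rw [mem_linesOn_map_iff E hfg, copl_map_iff]
  have h2 : {m' | m' ∈ linesOn f ∧ Copl (ℓ.map (E : (Fin 3 → K) →ᵃ[K] (Fin 3 → K))) m'} =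
      AffineSubspace.map (E.symm : (Fin 3 → K) →ᵃ[K] (Fin 3 → K)) ⁻¹'
        {m | m ∈ linesOn g ∧ Copl ℓ m} := by
    ext m'
    simp only [Set.mem_preimage, Set.mem_setOf_eq]
    rw [← mem_linesOn_map_iff E hfg, map_symm_map, ← copl_map_iff E ℓ, map_symm_map]
  constructor
  · intro h
    rw [h1]
    exact h.preimage (map_injective E).injOn
  · intro h
    rw [h2]
    exact h.preimage (map_injective E.symm).injOn

end AffEquiv

/-! ### Crossing points on a non-special line -/

section Crossing

/-- **At most `d - 1` crossing points on a non-special line** (Salmon Art. 485, Guth–Katz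
Lemma 3.4, Kollár Prop. 55 (5), elementary form; general line). Let `f` be irreducible of degree
`d ≥ 2` over an algebraically closed field, `S = {f = 0}` not a cylinder, every point of `S` on a
line of `S`. If the line `ℓ ⊆ S` is coplanar with only finitely many lines of `S`, then any
finite set of points of `ℓ`, each lying on another line of `S` that is itself coplanar with only
finitely many lines of `S`, has at most `d - 1` elements. (Reduced to the axis case
`card_crossing_le_of_axis` by the affine change of coordinates `x ↦ M x + a`, `M e₂ = u`,
`ℓ = {a + t u}`.) [cite: GuthKatz2015, Lemma 3.4] [cite: Kollar2015, Proposition 55 (5)] -/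
theorem card_crossing_le [IsAlgClosed K] {f : MvPolynomial (Fin 3) K}
    (hf : Irreducible f) (hd : 2 ≤ f.totalDegree)
    (hcyl : ¬ ∃ v : Fin 3 → K, v ≠ 0 ∧ ∀ (p : Fin 3 → K) (t : K),
      eval (p + t • v) f = eval p f)
    (hE : ∀ p : Fin 3 → K, eval p f = 0 → ∃ v : Fin 3 → K, v ≠ 0 ∧ ∀ t : K,
      eval (p + t • v) f = 0)
    {ℓ : AffineSubspace K (Fin 3 → K)} (hℓ : ℓ ∈ linesOn f)
    (hfin : Set.Finite {m | m ∈ linesOn f ∧ Copl ℓ m})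
    (P : Finset (Fin 3 → K))
    (hP : ∀ q ∈ P, q ∈ ℓ ∧ ∃ m ∈ linesOn f,
      m ≠ ℓ ∧ q ∈ m ∧ Set.Finite {m' | m' ∈ linesOn f ∧ Copl m m'}) :
    P.card + 1 ≤ f.totalDegree := by
  classical
  obtain ⟨a, u, hu, rfl⟩ := exists_eq_lineOf ℓ hℓ.1
  obtain ⟨M, hM, hMu⟩ := exists_matrix_mulVec_single_eq hu
  set E := affEquiv a M hM with hE_def
  set g := linSubst M (translate a f) with hg
  have hfg : ∀ x, eval x g = eval (E x) f := fun x => by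
    rw [hg, eval_affSubst, hE_def, affEquiv_apply]
  have hEaxis : (lineOf 0 (Pi.single 2 1)).map (E : (Fin 3 → K) →ᵃ[K] (Fin 3 → K)) =
      lineOf a u := by
    rw [map_lineOf, hE_def, affEquiv_apply, affEquiv_linear_apply, Matrix.mulVec_zero, zero_add,
      hMu]
  -- the hypotheses for `g = f ∘ E`
  have hgirr : Irreducible g := (irreducible_affSubst_iff hM).2 hf
  have hgdeg : g.totalDegree = f.totalDegree := totalDegree_affSubst a hM f
  have hEline : ∀ (p v : Fin 3 → K) (t : K), E (p + t • v) = E p + t • (M *ᵥ v) := by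
    intro p v t
    rw [hE_def, affEquiv_apply, affEquiv_apply, Matrix.mulVec_add, Matrix.mulVec_smul]
    abel
  have hgcyl : ¬ ∃ v : Fin 3 → K, v ≠ 0 ∧ ∀ (p : Fin 3 → K) (t : K),
      eval (p + t • v) g = eval p g := by
    rintro ⟨v, hv, h⟩
    refine hcyl ⟨M *ᵥ v, mulVec_ne_zero hM hv, fun p t => ?_⟩
    have h1 := h (E.symm p) t
    rw [hfg, hfg, hEline, E.apply_symm_apply] at h1
    exact h1
  have hgE : ∀ p : Fin 3 → K, eval p g = 0 → ∃ v : Fin 3 → K, v ≠ 0 ∧ ∀ t : K,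
      eval (p + t • v) g = 0 := by
    intro p hp
    rw [hfg] at hp
    obtain ⟨v, hv, hline⟩ := hE _ hp
    have hMinv : IsUnit M⁻¹.det := by
      rw [Matrix.det_nonsing_inv]
      exact hM.ringInverse
    refine ⟨M⁻¹ *ᵥ v, mulVec_ne_zero hMinv hv, fun t => ?_⟩
    rw [hfg, hEline, Matrix.mulVec_mulVec, Matrix.mul_nonsing_inv M hM, Matrix.one_mulVec]
    exact hline t
  have hgaxis : lineOf 0 (Pi.single 2 1) ∈ linesOn g := by
    rw [← mem_linesOn_map_iff E hfg, hEaxis]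
    exact hℓ
  have hgfin : Set.Finite {m | m ∈ linesOn g ∧ Copl (lineOf 0 (Pi.single 2 1)) m} := by
    rw [← finite_copl_map_iff E hfg, hEaxis]
    exact hfin
  -- transport the points
  have key := card_crossing_le_of_axis hgirr (by rw [hgdeg]; exact hd) hgcyl hgE hgaxis hgfin
    (P.image E.symm) ?_
  · rwa [card_image_of_injective _ E.symm.injective, hgdeg] at key
  · intro q' hq'
    obtain ⟨q, hq, rfl⟩ := mem_image.1 hq'
    obtain ⟨hqℓ, m, hm, hmne, hqm, hmfin⟩ := hP q hq
    refine ⟨?_, m.map (E.symm : (Fin 3 → K) →ᵃ[K] (Fin 3 → K)), ?_, ?_, ?_, ?_⟩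
    · rw [← hEaxis] at hqℓ
      obtain ⟨y, hy, hyq⟩ := AffineSubspace.mem_map.1 hqℓ
      rw [AffineEquiv.coe_toAffineMap] at hyq
      rw [← hyq, E.symm_apply_apply]
      exact hy
    · rw [← mem_linesOn_map_iff E hfg, map_symm_map]
      exact hm
    · intro h
      apply hmne
      rw [← map_symm_map E m, h, hEaxis]
    · exact AffineSubspace.mem_map.2 ⟨q, hqm, rfl⟩
    · rw [← finite_copl_map_iff E hfg, map_symm_map]
      exact hmfin

/-- **Kollár's Proposition 55 (4)+(5), affine elementary form (with `d - 1`).** Let `f` be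
irreducible of degree `d ≥ 3` over an algebraically closed field, `{f = 0}` generically ruled
(through every point off some `{h = 0}`, `f ∤ h`, passes a line of the surface), not a cone and
not a cylinder. Then there is a set `E` of at most two lines (the special ones,
`exists_finset_special`) such that every line `ℓ ∉ E` of the surface carries at most `d - 1`
points lying on another line `∉ E` of the surface (`card_crossing_le`; every point lies on a
line by `exists_line_through_of_generically_ruled`). Kollár's (5) has `d - 2` via intersection
theory on the smooth model; the bound `d - 1` is Guth–Katz's Lemma 3.4.
[cite: Kollar2015, Proposition 55 (4), (5)] [cite: GuthKatz2015, Lemma 3.4, Corollary 3.6] -/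
theorem crossing_bound_of_generically_ruled [IsAlgClosed K] {f : MvPolynomial (Fin 3) K}
    (hf : Irreducible f) (hd3 : 3 ≤ f.totalDegree)
    (hgr : ∃ h : MvPolynomial (Fin 3) K, ¬ f ∣ h ∧ ∀ p : Fin 3 → K, eval p f = 0 →
      eval p h ≠ 0 → ∃ ℓ : AffineSubspace K (Fin 3 → K), Module.finrank K ℓ.direction = 1 ∧
        p ∈ ℓ ∧ ∀ q ∈ ℓ, eval q f = 0)
    (hcone : ¬ ∃ p : Fin 3 → K, (translate p f).IsHomogeneous f.totalDegree)
    (hcyl : ¬ ∃ v : Fin 3 → K, v ≠ 0 ∧ ∀ (p : Fin 3 → K) (t : K),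
      eval (p + t • v) f = eval p f) :
    ∃ E : Finset (AffineSubspace K (Fin 3 → K)), E.card ≤ 2 ∧
      ∀ ℓ : AffineSubspace K (Fin 3 → K), Module.finrank K ℓ.direction = 1 →
        (∀ q ∈ ℓ, eval q f = 0) → ℓ ∉ E →
        ∀ P : Finset (Fin 3 → K),
          (∀ p ∈ P, p ∈ ℓ ∧ ∃ ℓ' : AffineSubspace K (Fin 3 → K),
            Module.finrank K ℓ'.direction = 1 ∧ (∀ q ∈ ℓ', eval q f = 0) ∧ ℓ' ≠ ℓ ∧ ℓ' ∉ E ∧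
              p ∈ ℓ') →
          P.card + 1 ≤ f.totalDegree := by
  obtain ⟨E, hE2, hEspec⟩ := exists_finset_special hf hd3 hcone hcyl
  refine ⟨E, hE2, fun ℓ hℓ1 hℓf hℓE P hP => ?_⟩
  -- every point of the surface lies on a line of the surface
  have hEPL : ∀ p : Fin 3 → K, eval p f = 0 → ∃ v : Fin 3 → K, v ≠ 0 ∧ ∀ t : K,
      eval (p + t • v) f = 0 := by
    intro p hp
    obtain ⟨m, hm, hpm⟩ := exists_mem_linesOn_of_generically_ruled hf hgr hp
    obtain ⟨v, hv, rfl⟩ := exists_eq_lineOf_of_mem m hm.1 hpm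
    exact ⟨v, hv, (lineOf_mem_linesOn_iff p hv).1 hm⟩
  have hℓ : ℓ ∈ linesOn f := ⟨hℓ1, hℓf⟩
  have hfin : Set.Finite {m | m ∈ linesOn f ∧ Copl ℓ m} := by
    by_contra h
    exact hℓE (hEspec ℓ hℓ h)
  refine card_crossing_le hf (by omega) hcyl hEPL hℓ hfin P fun q hq => ?_
  obtain ⟨hqℓ, ℓ', hℓ'1, hℓ'f, hne, hℓ'E, hqℓ'⟩ := hP q hq
  refine ⟨hqℓ, ℓ', ⟨hℓ'1, hℓ'f⟩, hne, hqℓ', ?_⟩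
  by_contra h
  exact hℓ'E (hEspec ℓ' ⟨hℓ'1, hℓ'f⟩ h)

end Crossing

end Literature.Combinatorics.Extremal
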